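import Summits.ValiantsHypothesis.ValiantsHypothesis.Theorems.GrenetZeonDualUnipotentThreeHalvesLongMassCeilings
import Summits.ValiantsHypothesis.ValiantsHypothesis.Theorems.GrenetZeonDualUnipotentThreeHalvesHeavyTopBand
import Summits.ValiantsHypothesis.ValiantsHypothesis.Theorems.GrenetZeonDualUnipotentThreeHalvesHeavyTopInvariantFlag
import Summits.ValiantsHypothesis.ValiantsHypothesis.Theorems.GrenetZeonDualUnipotentThreeHalvesLongMassResolventFlag

/-!
# `GrenetZeon.DualUnipotentThreeHalves` (stmt-ValiantsHypothesis-24318), line `slow_core`, stub (c) `SlowCore.LongMassSlowLawInv`: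
# GERSTENHABER IN MASS CURRENCY — the coarsening law at order `0` holds with the sharp constant; (c) holds on the small-size locus `b ≤ 2c√n + 1`

The ceiling U1 of the (c)-census (✓ `Ceilings.relCert_freeze`: the freezing space is an order-`0` whole-pencil ledger of price `mass N`) was priced by
`mass N ≤ b²` (✓ `Ceilings.mass_le_sq`).  For a NILPOTENT affine pencil the mass is the dimension of the linear-part space `{lin v}`, a linear space of
nilpotent matrices (✓ `RadicalSplit.linPart_pow_eq_zero`), so GERSTENHABER's theorem (✓ `Literature…finrank_le_choose_two`, via ✓
`RadicalSplit.finrank_range_top_le_choose_two`) sharpens it to `mass N ≤ C(b, 2) = b(b−1)/2`: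

* ★ `mass_eq_finrank_range` — `mass N = dim range(lin)` (rank–nullity; `ker lin = freezeSpace N univ`);
* ★ `mass_le_choose_two` — `mass N ≤ C(b,2)` for every nilpotent affine pencil (Gerstenhaber in mass currency);
* ★ `relCert_choose_two` — U1♯: every nilpotent affine pencil has a certificate of price `≤ C(b,2)`;
* ★ `coarsening_order_zero` — the COARSENING LAW of ✓ `…LongMassCoarseningLaw` at order `k = 0` with the SHARP constant: an order-`0` ledger `K` with
  `codim K · (0+1) ≤ C(b,2)` ("Gerstenhaber = coarsening at order 0"; at order `1` the sharp form already fails for the `3×3` gadget, memo §4);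
* ★ `relCert_sqrt_of_size_le`, `longMass_on_small_locus` — BY NAME: (c) HOLDS, with the SAME constant `c`, for every nilpotent affine pencil of size
  `b ≤ 2c·√n + 1` (`C(b,2) ≤ c·√n·b`); so a (c)-violator family has `b > 2c√n + 1` on top of `mass > c√n·b` (memo `FIFTEENTH-HAND.md` §3).

HONEST FRAMING.  Support lemmas (`--supports stmt-ValiantsHypothesis-24318`); NOT progress on (c) `LongMassSlowLawInv` beyond the small-size locus
(RESEARCH — OPEN); S3, 24318, 8062 and `VP ≠ VNP` are NOT proved.  Def-free; cites Gerstenhaber only through the tree's Literature theorem.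
-/

set_option linter.dupNamespace false
set_option autoImplicit false

noncomputable section

namespace Summit.ValiantsHypothesis.ValiantsHypothesis.Theorems.GrenetZeon.GerstenhaberMass

open MvPolynomial Matrix
open scoped BigOperators
open Summit.ValiantsHypothesis.ValiantsHypothesis.Cruxes.TwoDimCoefficients.DimTwoCases (AffMat IsAffine)
open Summit.ValiantsHypothesis.ValiantsHypothesis.Theorems.GrenetZeon.RadicalSplit (lineSubst linPart finrank_range_top_le_choose_two)
open Summit.ValiantsHypothesis.ValiantsHypothesis.Theorems.GrenetZeon.HeavyTopInvariantFlag (linPart_eq_coeff)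
open Summit.ValiantsHypothesis.ValiantsHypothesis.Theorems.GrenetZeon.SlowCore
  (linEntry Ledger RelCert freezeSpace linFun linFun_apply linEntry_eq_zero_of_mem_freezeSpace totalDegree_map_C_pow_apply)
open Summit.ValiantsHypothesis.ValiantsHypothesis.Theorems.GrenetZeon.Ceilings (mass relCert_freeze relCert_mono
  map_lineSubst_of_mem_freezeSpace_univ)

variable {n m : ℕ}

/-! ## §1 The mass is the rank of the linear part -/

/-- `v` freezes every position iff its linear part vanishes entrywise. -/
theorem mem_freezeSpace_univ_iff (N : AffMat n m) (v : Fin n × Fin n → ℂ) :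
    v ∈ freezeSpace N (Finset.univ : Finset (Fin m × Fin m)) ↔ ∀ i j : Fin m, linEntry N i j v = 0 := by
  constructor
  · intro hv i j
    exact linEntry_eq_zero_of_mem_freezeSpace N Finset.univ (Finset.mem_univ _) hv
  · intro h
    rw [freezeSpace, LinearMap.mem_ker]
    funext r
    rw [LinearMap.pi_apply, linFun_apply]
    exact h r.1.1 r.1.2

/-- The linear part `N(v) − N(0)` of an affine pencil has entries `linEntry N i j v`. -/
theorem linPart_apply (N : AffMat n m) (hN : IsAffine N) (v : Fin n × Fin n → ℂ) (i j : Fin m) :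
    linPart N v i j = linEntry N i j v := by
  rw [linPart_eq_coeff N hN v]
  rfl

/-- ★ **MASS = RANK OF THE LINEAR PART.**  For the linear map `T : v ↦ N(v) − N(0)` (✓ `exists_topMap`), `ker T = freezeSpace N univ`, hence
`mass N = dim range T`. [rank–nullity] -/
theorem mass_eq_finrank_range (N : AffMat n m) (hN : IsAffine N) (T : (Fin n × Fin n → ℂ) →ₗ[ℂ] Matrix (Fin m) (Fin m) ℂ)
    (hT : ∀ v, T v = linPart N v) : mass N = Module.finrank ℂ (LinearMap.range T) := by
  have hker : LinearMap.ker T = freezeSpace N (Finset.univ : Finset (Fin m × Fin m)) := by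
    ext v
    rw [LinearMap.mem_ker, mem_freezeSpace_univ_iff, hT]
    constructor
    · intro h i j
      rw [← linPart_apply N hN v i j, h]
      rfl
    · intro h
      ext i j
      rw [linPart_apply N hN v i j, h i j]
      rfl
  have hrn := LinearMap.finrank_range_add_finrank_ker T
  have hdom : Module.finrank ℂ (Fin n × Fin n → ℂ) = n * n := by
    rw [Module.finrank_pi, Fintype.card_prod, Fintype.card_fin]
  rw [hdom, hker] at hrn
  rw [mass]
  omega

/-- ★ **GERSTENHABER IN MASS CURRENCY.**  A nilpotent affine `b × b` pencil has `mass ≤ C(b, 2)`: its linear parts form a linear space of nilpotent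
matrices (✓ `linPart_pow_eq_zero`), bounded by Gerstenhaber (✓ `finrank_range_top_le_choose_two`). [Gerstenhaber 1958, via the tree] -/
theorem mass_le_choose_two (N : AffMat n m) (hN : IsAffine N) (hnil : N ^ m = 0) : mass N ≤ m.choose 2 := by
  obtain ⟨T, hT⟩ :=
    Summit.ValiantsHypothesis.ValiantsHypothesis.Theorems.DualUnipotentThreeHalvesNegative.RadicalSplit.exists_topMap N hN
  have hT' : ∀ v, T v = linPart N v := fun v => hT v
  rw [mass_eq_finrank_range N hN T hT']
  exact finrank_range_top_le_choose_two N hN hnil T hT'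

/-! ## §2 U1♯ and the coarsening law at order zero -/

/-- ★ **U1♯.**  Every nilpotent affine `b × b` pencil has a whole-pencil certificate of price `≤ C(b, 2)` (freeze everything; Gerstenhaber). -/
theorem relCert_choose_two (N : AffMat n m) (hN : IsAffine N) (hnil : N ^ m = 0) : RelCert n m N (m.choose 2) :=
  relCert_mono (relCert_freeze N hN) (mass_le_choose_two N hN hnil)

/-- ★ **THE COARSENING LAW AT ORDER `0`, SHARP CONSTANT** ("Gerstenhaber = coarsening at order 0"): an order-`0` whole-pencil ledger `K` (the freezing
space) with `codim K · (0 + 1) ≤ C(b, 2)`.  Compare ✓ `CoarseningLaw.relCert_of_coarsening_all` (the law at every order gives (c)). -/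
theorem coarsening_order_zero (N : AffMat n m) (hN : IsAffine N) (hnil : N ^ m = 0) :
    ∃ K : Submodule ℂ (Fin n × Fin n → ℂ), Ledger n m N (fun _ => True) K 0 ∧
      (n * n - Module.finrank ℂ K) * (0 + 1) ≤ m.choose 2 := by
  refine ⟨freezeSpace N Finset.univ, fun x v hv b _ i j _ _ => ?_, ?_⟩
  · rw [map_lineSubst_of_mem_freezeSpace_univ N hN x v hv]
    exact (totalDegree_map_C_pow_apply _ b i j).le
  · rw [Nat.zero_add, Nat.mul_one]
    exact mass_le_choose_two N hN hnil

/-! ## §3 (c) on the small-size locus -/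

/-- `C(b,2) ≤ c·√n·b` as soon as `b ≤ 2c·√n + 1`. [arithmetic] -/
theorem choose_two_le_of_size_le {c b : ℕ} (hb : b ≤ 2 * c * Nat.sqrt n + 1) : b.choose 2 ≤ c * (Nat.sqrt n * b) := by
  rw [Nat.choose_two_right]
  apply Nat.div_le_of_le_mul
  have h1 : b - 1 ≤ 2 * c * Nat.sqrt n := by omega
  calc b * (b - 1) ≤ b * (2 * c * Nat.sqrt n) := Nat.mul_le_mul_left _ h1
    _ = 2 * (c * (Nat.sqrt n * b)) := by ring

/-- ★ **(c) ON THE SMALL-SIZE LOCUS, same constant.**  A nilpotent affine pencil of size `b ≤ 2c·√n + 1` has a certificate of price `≤ c·√n·b`. -/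
theorem relCert_sqrt_of_size_le (N : AffMat n m) (hN : IsAffine N) (hnil : N ^ m = 0) {c : ℕ}
    (hm : m ≤ 2 * c * Nat.sqrt n + 1) : RelCert n m N (c * (Nat.sqrt n * m)) :=
  relCert_mono (relCert_choose_two N hN hnil) (choose_two_le_of_size_le hm)

/-- ★ **BY NAME: the research stub (c) restricted to sizes `b ≤ 2c·√n + 1` HOLDS for every `c` and every `n`** (no irreducibility needed).  Hence a
(c)-violator family must have `b > 2c·√n + 1` (and `mass > c·√n·b`, ✓ `LedgerIndex.mass_le_of_ledger_zero`): the content of (c) lives at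
`2c√n < b` — together with the window this is the band located in memo `FIFTEENTH-HAND.md` §3.  NOT progress on (c) beyond this locus. -/
theorem longMass_on_small_locus (c n b : ℕ) (hb : b ≤ 2 * c * Nat.sqrt n + 1) (B : AffMat n b) (hB : IsAffine B) (hnil : B ^ b = 0) :
    RelCert n b B (c * (Nat.sqrt n * b)) :=
  relCert_sqrt_of_size_le B hB hnil hb

end Summit.ValiantsHypothesis.ValiantsHypothesis.Theorems.GrenetZeon.GerstenhaberMass

end
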